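import Summits.AnomalousDissipation.AnomalousDissipation.Theorems.GalerkinSteadyZerothLaw.Negative.StokesStates
import Summits.AnomalousDissipation.AnomalousDissipation.Theorems.MirrorVarietyGalerkinSteadyZerothLawCellCore
import Literature.Analysis.FluidPDE.NSGalerkinStationary

/-!
# Line `laminar-component-split` — crux `MirrorVariety.GalerkinSteadyZerothLaw` (stmt-AnomalousDissipation-2986):
# the strategist's TYPED DECOMPOSITION registered as a two-stub skeleton

Crux-strategist output (b) (BC2 REDIRECT re-exam of the deciding crux, 2026-08-17).  The two registered stubs are the
two SPLIT CHILDREN of the crux in the route (`CellLaminarComponentReachesZero`, `CellLaminarComponentStaysLoud`,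
route edit `--split GalerkinSteadyZerothLaw`), verbatim; the composition `GalerkinSteadyZerothLaw_of` is, binder for binder, the assembly
`galerkinSteadyZerothLaw_of_subs` of the tree-bound file `Theorems/MirrorVarietyGalerkinSteadyZerothLawSplit.lean`
(attached as item evidence; Theorems/ is prover-only, so a prover lands it and closes the route's glue item).

OBJECT.  The cell force `f_cell = (sin 2πx cos 2πy, −cos 2πx sin 2πy, 0)` (family `cellCoeff` on `(±1,±1,0)`, exact
Euler core, `−Δf = 8π²f`, `∫|f|² = ½`, laminar state `f/(8π²ν)`); the class `Fix τ`, `τ : (x,y,z) ↦ (x+½, y+½, z)`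
(coefficients vanish at `k` with `k₀+k₁` odd) — invariant, contains EVERY 3-D steady bifurcation of the laminar state
and excludes the planar one (kit j021913: rungs by vertical wavenumber `m` and `τ`-parity at `N = 4…16`; 3-D rungs all
`τ`-even — `m=1: ν=0.00528`, `m=2: 0.00691` (top, `E_lam = 1.68`), `m=3: 0.00471`, `m=4: 0.00382` at `N=16`,
`N`-converged — the only `τ`-odd rung planar, `m=0`, `ν = 0.00909`; `m=0` `τ`-even: none, as planar `τ`-even steady
states are exactly laminar by the 2-D enstrophy identity `Σ|k|²(|k|²−2)|c_k|² = 0`);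
`F_N(E) = {(c,ν) : c ∈ galerkinSubspace (modes N) ∩ Fix τ, 0 < ν, galerkinRHS (modes N) ν C_N c = 0, energy c ≤ E}`;
`Comp_N(E,ν₀) =` connected component of the laminar point `(C_N/(8π²ν₀), ν₀)` in `F_N(E)`.

STUBS (both crux-sized, structurally different, neither the crux: probes `→ X`, `→ S` fail, folder `bc/`):
* `stub_reach` = R `CellLaminarComponentReachesZero` — TOPOLOGY: ∃ `E, ν₀ > 0`, ∀ `ν₁ > 0`, frequently in `N`,
  `Comp_N(E,ν₀)` contains a state with `ν ≤ ν₁` (bounded `τ`-laminar component reaches zero viscosity; no loudness).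
* `stub_loud` = L `CellLaminarComponentStaysLoud` — ESTIMATE: ∀ `E, ν₀ > 0` ∃ `ν₁, ε, κ, N₁`: for `N ≥ N₁` every state of
  `Comp_N(E,ν₀)` with `κ/N² ≤ ν ≤ ν₁` has `ν·4π²Σ|k|²|c_k|² ≥ ε` (non-depletion in the resolved window; no existence).
COMPOSITION `GalerkinSteadyZerothLaw_of : R → L → GalerkinSteadyZerothLaw` (kernel-checked, no sorry): builds the crux's
`N`-independent `ν_j := min ν₁ ν₀/(j+2)` by the IVT on the viscosity projection of the preconnected component (R reaches
below `ν_j`, the anchor sits above), intersects `∃ᶠ N` with the eventual side conditions (`N ≥ N₁`, `N ≥ 2`, `κ/N² ≤ ν_j`),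
applies L on the slice, and runs the landed dictionary (`fieldOf`, `steadyState_fieldOf`, Parseval, `crux_iff`).

WHY IT DODGES THE STUCK GOAL of line `idea-sketch-ideator2` v4 (`stub_cellLoud` = the crux at the cell force): existence
of a state AT `a_j` is no longer a stub — it is manufactured by connectedness from R — and loudness is no longer bundled
with existence: L is a pure a-priori estimate on a canonical set (refutable by ONE quiet bounded state connected to
laminar; provable without constructing anything), R a pure continuation statement (no budgets but energy).
Disproof used (`Disproof.lean` cycles 1–2, NO KILL): §3 load-bearing (bounded ∧ loud ∧ `ν→0`, `E` uniform) — bounded+`ν→0`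
sit in R, loud in L, `E`-uniformity in R's single `E`; §4 dimension — planar states quiet: removed by `Fix τ` (planar
`τ`-even steady = laminar, outside the energy ball at small `ν`); §5 `not_crux_iff` — ¬L is a laminarisation theorem
ALONG THE LAMINAR COMPONENT only.  `-- Targets`: none.  Negatives index: no instance relation.
-/

noncomputable section

-- `Summit.<Summit>.<Problem>` is the tree's mandated summit-side namespace (CONVENTIONS §2); deliberate duplicate.
set_option linter.dupNamespace false

open scoped InnerProductSpace Topology
open MeasureTheory Filter Set UnitAddTorus
open Literature.Analysis.FunctionSpaces Literature.Analysis.FunctionSpaces.Torus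
open Literature.Analysis.FluidPDE Literature.Analysis.FluidPDE.Torus

namespace Summit.AnomalousDissipation.AnomalousDissipation.Cruxes.GalerkinSteadyZerothLaw.LaminarComponentSplit

open Summit.AnomalousDissipation.AnomalousDissipation.Theorems.GalerkinSteadyZerothLaw (cellCoeff cellShell stub_cellCoreTools)

open Summit.AnomalousDissipation.AnomalousDissipation.Theses.MirrorVariety (GalerkinSteadyZerothLaw)
open Summit.AnomalousDissipation.AnomalousDissipation.Theorems.GalerkinSteadyZerothLaw.Negative
  (SteadyState BandLimited FrequentlyLoud LoudWitness crux_iff fieldOf steadyState_fieldOf integral_norm_sq_fieldOf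
    loudness_fieldOf)
open Summit.AnomalousDissipation.AnomalousDissipation.Theorems.LaminarNeverLoud.Negative
  (modes forceCoeff energy dissipation modes_symm zero_not_mem_modes)

/-! ## §1 The cell family is its own explicit lambda; the cell force vector at level `N` -/

/-- `cellCoeff` is, definitionally, the explicit lambda written into the two split children. [folklore] -/
theorem cellCoeff_eq_lambda : cellCoeff = (fun l : Fin 3 → ℤ =>
    if l ∈ Fintype.piFinset ![({1, -1} : Finset ℤ), {1, -1}, {0}] then
      (Complex.I * (l 0 : ℂ) * (l 1 : ℂ) / 4) • !₂[-((l 1 : ℤ) : ℂ), ((l 0 : ℤ) : ℂ), 0] else 0) := rfl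

/-- The zero-extension of the level-`2` cell vector is the whole family `cellCoeff` (support in `modes 2`). [folklore] -/
theorem coeffExt_cell_two :
    coeffExt (modes (Fin 3) 2) (fun k : ↥(modes (Fin 3) 2) => cellCoeff k) = cellCoeff := by
  funext k
  by_cases hk : k ∈ modes (Fin 3) 2
  · rw [coeffExt_of_mem _ hk]
  · rw [coeffExt_of_not_mem _ hk, stub_cellCoreTools.1 k hk]

/-- **The cell force field.**  `f_cell := fieldOf 2 (cellCoeff|modes 2)` is smooth, divergence free, mean zero, square
integrable, and its Fourier force vector at EVERY level `N` is `cellCoeff` read on `modes N`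
(`mFourierCoeff_realTrigPoly` + `coeffExt_cell_two`). [folklore] -/
theorem cellForce_admissible :
    IsSmooth (fieldOf 2 (fun k : ↥(modes (Fin 3) 2) => cellCoeff k)) ∧
    IsDivFree (fieldOf 2 (fun k : ↥(modes (Fin 3) 2) => cellCoeff k)) ∧
    HasZeroMean (fieldOf 2 (fun k : ↥(modes (Fin 3) 2) => cellCoeff k)) ∧
    MemLp (fieldOf 2 (fun k : ↥(modes (Fin 3) 2) => cellCoeff k)) 2 volume ∧
    ∀ N : ℕ, forceCoeff (modes (Fin 3) N) (fieldOf 2 (fun k : ↥(modes (Fin 3) 2) => cellCoeff k)) =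
      fun k : ↥(modes (Fin 3) N) => cellCoeff k := by
  -- (the landed `stub_coreForce`, `Theorems/MirrorVarietyGalerkinSteadyZerothLawStubCoreForce.lean`, run at `N₀ = 2`
  -- on the cell vector; re-proved inline because that module has no farm olean at the time of writing)
  have hC₂ : (fun k : ↥(modes (Fin 3) 2) => cellCoeff k) ∈ galerkinSubspace (modes (Fin 3) 2) :=
    (stub_cellCoreTools.2 2 le_rfl).1
  have hS : ∀ k ∈ modes (Fin 3) 2, -k ∈ modes (Fin 3) 2 := modes_symm 2
  have hS0 : (0 : Fin 3 → ℤ) ∉ modes (Fin 3) 2 := zero_not_mem_modes 2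
  have hCsymm : IsConjSymm (coeffExt (modes (Fin 3) 2) (fun k : ↥(modes (Fin 3) 2) => cellCoeff k)) :=
    hC₂.1.isConjSymm_coeffExt hS
  have hCT : IsTransversal (modes (Fin 3) 2) (coeffExt (modes (Fin 3) 2) (fun k : ↥(modes (Fin 3) 2) => cellCoeff k)) :=
    hC₂.2.isTransversal_coeffExt
  have hfs : IsSmooth (fieldOf 2 (fun k : ↥(modes (Fin 3) 2) => cellCoeff k)) := isSmooth_realTrigPoly _ _
  refine ⟨hfs, isDivFree_realTrigPoly hCT, hasZeroMean_realTrigPoly_of_zero_not_mem hS0 _,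
    hfs.continuous.memLp_of_hasCompactSupport (HasCompactSupport.of_compactSpace _), fun N => ?_⟩
  funext k
  show mFourierCoeff (EuclideanSpace.complexify ∘
      realTrigPoly (modes (Fin 3) 2) (coeffExt (modes (Fin 3) 2) (fun k : ↥(modes (Fin 3) 2) => cellCoeff k)))
      (k : Fin 3 → ℤ) = cellCoeff k
  rw [mFourierCoeff_realTrigPoly hS hCsymm, coeffExt_cell_two]
  split_ifs with hk
  · rfl
  · exact (stub_cellCoreTools.1 k hk).symm

/-! ## §2 The intermediate value step on a component -/

/-- **IVT on the viscosity projection of a connected component.**  If the component of `x₀` in `F ⊆ X × ℝ` contains a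
point `z` with `z.2 ≤ a ≤ x₀.2`, it contains a point with second coordinate EXACTLY `a` (the continuous image of a
preconnected set in `ℝ` is order-connected). [folklore] -/
theorem exists_mem_connectedComponentIn_snd_eq {X : Type*} [TopologicalSpace X] {F : Set (X × ℝ)} {x₀ z : X × ℝ}
    (hz : z ∈ connectedComponentIn F x₀) {a : ℝ} (hza : z.2 ≤ a) (hax : a ≤ x₀.2) :
    ∃ w ∈ connectedComponentIn F x₀, w.2 = a := by
  have hx₀F : x₀ ∈ F := by
    by_contra h
    rw [connectedComponentIn_eq_empty h] at hz
    exact hz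
  have hx₀ : x₀ ∈ connectedComponentIn F x₀ := mem_connectedComponentIn hx₀F
  have hpre : IsPreconnected (Prod.snd '' connectedComponentIn F x₀) :=
    isPreconnected_connectedComponentIn.image _ continuous_snd.continuousOn
  have hsub := hpre.Icc_subset (mem_image_of_mem Prod.snd hz) (mem_image_of_mem Prod.snd hx₀)
  obtain ⟨w, hw, hwa⟩ := hsub ⟨hza, hax⟩
  exact ⟨w, hw, hwa⟩

/-! ## §3 Registered stubs (= the two split children, verbatim) -/

/-- **stub_reach** = split child `CellLaminarComponentReachesZero` (crux; TOPOLOGY / global continuation): the bounded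
`τ`-symmetric laminar component of the cell-forced Galerkin system reaches zero viscosity with one energy budget at
infinitely many resolutions.  No loudness asserted. -/
theorem stub_reach : ∀ C : (Fin 3 → ℤ) → EuclideanSpace ℂ (Fin 3), C = (fun l : Fin 3 → ℤ => if l ∈ Fintype.piFinset ![({1, -1} : Finset ℤ), {1, -1}, {0}] then (Complex.I * (l 0 : ℂ) * (l 1 : ℂ) / 4) • !₂[-((l 1 : ℤ) : ℂ), ((l 0 : ℤ) : ℂ), 0] else 0) → ∃ E ν₀ : ℝ, 0 < ν₀ ∧ ∀ ν₁ : ℝ, 0 < ν₁ → ∃ᶠ N in Filter.atTop, ∀ S : Finset (Fin 3 → ℤ), S = (Literature.Analysis.FunctionSpaces.Torus.freqBall N).erase (0 : Fin 3 → ℤ) → ∀ F : Set ((↥S → EuclideanSpace ℂ (Fin 3)) × ℝ), F = {z | z.1 ∈ Literature.Analysis.FluidPDE.galerkinSubspace S ∧ (∀ k : ↥S, Odd ((k : Fin 3 → ℤ) 0 + (k : Fin 3 → ℤ) 1) → z.1 k = 0) ∧ 0 < z.2 ∧ Literature.Analysis.FluidPDE.galerkinRHS S z.2 (fun k : ↥S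 => C k) z.1 = 0 ∧ ∑ k : ↥S, ‖z.1 k‖ ^ 2 ≤ E} → ∃ z ∈ connectedComponentIn F ((fun k : ↥S => (8 * Real.pi ^ 2 * ν₀)⁻¹ • C k), ν₀), z.2 ≤ ν₁ := by
  sorry

/-- **stub_loud** = split child `CellLaminarComponentStaysLoud` (crux; ESTIMATE / non-depletion): within bounded energy the
laminar component stays loud down to zero viscosity, uniformly in `N`, in the resolved window `ν ≥ κ/N²`.  No existence
asserted. -/
theorem stub_loud : ∀ C : (Fin 3 → ℤ) → EuclideanSpace ℂ (Fin 3), C = (fun l : Fin 3 → ℤ => if l ∈ Fintype.piFinset ![({1, -1} : Finset ℤ), {1, -1}, {0}] then (Complex.I * (l 0 : ℂ) * (l 1 : ℂ) / 4) • !₂[-((l 1 : ℤ) : ℂ), ((l 0 : ℤ) : ℂ), 0] else 0) → ∀ E ν₀ : ℝ, 0 < ν₀ → ∃ ν₁ ε κ : ℝ, 0 < ν₁ ∧ 0 < ε ∧ ∃ N₁ : ℕ, ∀ N : ℕ, N₁ ≤ N → ∀ S : Finset (Fin 3 → ℤ), S = (Literature.Analysis.FunctionSpaces.Torus.freqBall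 N).erase (0 : Fin 3 → ℤ) → ∀ F : Set ((↥S → EuclideanSpace ℂ (Fin 3)) × ℝ), F = {z | z.1 ∈ Literature.Analysis.FluidPDE.galerkinSubspace S ∧ (∀ k : ↥S, Odd ((k : Fin 3 → ℤ) 0 + (k : Fin 3 → ℤ) 1) → z.1 k = 0) ∧ 0 < z.2 ∧ Literature.Analysis.FluidPDE.galerkinRHS S z.2 (fun k : ↥S => C k) z.1 = 0 ∧ ∑ k : ↥S, ‖z.1 k‖ ^ 2 ≤ E} → ∀ z ∈ connectedComponentIn F ((fun k : ↥S => (8 * Real.pi ^ 2 * ν₀)⁻¹ • C k), ν₀), κ / (N : ℝ) ^ 2 ≤ z.2 → z.2 ≤ ν₁ → ε ≤ z.2 * (4 * Real.pi ^ 2 * ∑ k : ↥S, Literature.Analysis.FunctionSpaces.Torus.freqNormSq (k : Fin 3 → ℤ) * ‖z.1 k‖ ^ 2) := by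
  sorry


/-! ## §4 The assembly (hypothesis form) and the composition BY NAME (kernel-checked, no sorry outside the stubs) -/

/-- **The unfolded crux from the two split children** (hypothesis form; `crux_iff` turns it into the route decl) (`CellLaminarComponentReachesZero`,
`CellLaminarComponentStaysLoud`; hypotheses written VERBATIM as the route decls' bodies, so that
`Theses.MirrorVariety.CellLaminarComponentReachesZero → Theses.MirrorVariety.CellLaminarComponentStaysLoud →
GalerkinSteadyZerothLaw` is this theorem by `δ`-unfolding).  Proof: instantiate both at the cell family (`rfl`); take
`E, ν₀` from R and `ν₁, ε, κ, N₁` from L at `(E, ν₀)`; the crux's viscosities are `ν_j := min ν₁ ν₀ / (j + 2) → 0⁺`,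
the SAME for every resolution.  For each `j`: R (at threshold `ν_j`) holds frequently in `N`; intersect with the
eventual conditions `N ≥ N₁`, `N ≥ 2`, `κ/N² ≤ ν_j`; in the component the anchor has viscosity `ν₀ ≥ ν_j` and R's state
has viscosity `≤ ν_j`, so by the IVT (`exists_mem_connectedComponentIn_snd_eq`) the component meets the slice `ν = ν_j`
at a state `w`: real solenoidal, a zero of the cell-forced Galerkin field, `energy ≤ E` (membership in `F`), and LOUD by L
(it lies in the resolved window).  The dictionary `fieldOf` / `steadyState_fieldOf` / Parseval turns `w` into an
admissible tested-form state of `f_cell` with `∫|U|² ≤ E` and `ν_j‖∇U‖² ≥ ε`; `crux_iff` closes. [folklore] -/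
theorem loudWitness_of_subs
    (hR : ∀ C : (Fin 3 → ℤ) → EuclideanSpace ℂ (Fin 3), C = (fun l : Fin 3 → ℤ => if l ∈ Fintype.piFinset ![({1, -1} : Finset ℤ), {1, -1}, {0}] then (Complex.I * (l 0 : ℂ) * (l 1 : ℂ) / 4) • !₂[-((l 1 : ℤ) : ℂ), ((l 0 : ℤ) : ℂ), 0] else 0) → ∃ E ν₀ : ℝ, 0 < ν₀ ∧ ∀ ν₁ : ℝ, 0 < ν₁ → ∃ᶠ N in Filter.atTop, ∀ S : Finset (Fin 3 → ℤ), S = (Literature.Analysis.FunctionSpaces.Torus.freqBall N).erase (0 : Fin 3 → ℤ) → ∀ F : Set ((↥S → EuclideanSpace ℂ (Fin 3)) × ℝ), F = {z | z.1 ∈ Literature.Analysis.FluidPDE.galerkinSubspace S ∧ (∀ k : ↥S, Odd ((k : Fin 3 → ℤ) 0 + (k : Fin 3 → ℤ) 1) → z.1 k = 0) ∧ 0 < z.2 ∧ Literature.Analysis.FluidPDE.galerkinRHS S z.2 (fun k : ↥S => C k) z.1 = 0 ∧ ∑ k : ↥S, ‖z.1 k‖ ^ 2 ≤ E} → ∃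 z ∈ connectedComponentIn F ((fun k : ↥S => (8 * Real.pi ^ 2 * ν₀)⁻¹ • C k), ν₀), z.2 ≤ ν₁)
    (hL : ∀ C : (Fin 3 → ℤ) → EuclideanSpace ℂ (Fin 3), C = (fun l : Fin 3 → ℤ => if l ∈ Fintype.piFinset ![({1, -1} : Finset ℤ), {1, -1}, {0}] then (Complex.I * (l 0 : ℂ) * (l 1 : ℂ) / 4) • !₂[-((l 1 : ℤ) : ℂ), ((l 0 : ℤ) : ℂ), 0] else 0) → ∀ E ν₀ : ℝ, 0 < ν₀ → ∃ ν₁ ε κ : ℝ, 0 < ν₁ ∧ 0 < ε ∧ ∃ N₁ : ℕ, ∀ N : ℕ, N₁ ≤ N → ∀ S : Finset (Fin 3 → ℤ), S = (Literature.Analysis.FunctionSpaces.Torus.freqBall N).erase (0 : Fin 3 → ℤ) → ∀ F : Set ((↥S → EuclideanSpace ℂ (Fin 3)) × ℝ), F = {z | z.1 ∈ Literature.Analysis.FluidPDE.galerkinSubspace S ∧ (∀ k : ↥S, Odd ((k : Fin 3 → ℤ) 0 + (k : Fin 3 → ℤ) 1) → z.1 k = 0) ∧ 0 < z.2 ∧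 Literature.Analysis.FluidPDE.galerkinRHS S z.2 (fun k : ↥S => C k) z.1 = 0 ∧ ∑ k : ↥S, ‖z.1 k‖ ^ 2 ≤ E} → ∀ z ∈ connectedComponentIn F ((fun k : ↥S => (8 * Real.pi ^ 2 * ν₀)⁻¹ • C k), ν₀), κ / (N : ℝ) ^ 2 ≤ z.2 → z.2 ≤ ν₁ → ε ≤ z.2 * (4 * Real.pi ^ 2 * ∑ k : ↥S, Literature.Analysis.FunctionSpaces.Torus.freqNormSq (k : Fin 3 → ℤ) * ‖z.1 k‖ ^ 2)) :
    ∃ f : UnitAddTorus (Fin 3) → EuclideanSpace ℝ (Fin 3), IsSmooth f ∧ IsDivFree f ∧ HasZeroMean f ∧ LoudWitness f := by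
  -- both pieces at the cell family
  obtain ⟨E, ν₀, hν₀, hreach⟩ := hR cellCoeff cellCoeff_eq_lambda
  obtain ⟨ν₁, ε, κ, hν₁, hε, N₁, hloud⟩ := hL cellCoeff cellCoeff_eq_lambda E ν₀ hν₀
  obtain ⟨hfs, hfd, hfm, hfmem, hfcoeff⟩ := cellForce_admissible
  -- the crux's viscosity sequence, the same for every resolution
  set m : ℝ := min ν₁ ν₀ with hm
  have hm0 : 0 < m := lt_min hν₁ hν₀
  set ν : ℕ → ℝ := fun j => m / ((j : ℝ) + 2) with hνdef
  have hνpos : ∀ j, 0 < ν j := fun j => by positivity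
  have hνle : ∀ j, ν j ≤ m := fun j => by
    have h2 : (1 : ℝ) ≤ (j : ℝ) + 2 := by
      have : (0 : ℝ) ≤ j := Nat.cast_nonneg j
      linarith
    exact div_le_self hm0.le h2
  have hνlim : Tendsto ν atTop (𝓝 0) := by
    have h1 : Tendsto (fun j : ℕ => (j : ℝ) + 2) atTop atTop :=
      tendsto_natCast_atTop_atTop.atTop_add tendsto_const_nhds
    exact tendsto_const_nhds.div_atTop h1
  refine ⟨fieldOf 2 (fun k : ↥(modes (Fin 3) 2) => cellCoeff k), hfs, hfd, hfm, ν, E, ε, hνpos, hνlim,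
    hε, fun j => ?_⟩
  -- eventual side conditions on the resolution
  have hκ : ∀ᶠ N : ℕ in atTop, κ / (N : ℝ) ^ 2 ≤ ν j := by
    have hsq : Tendsto (fun N : ℕ => (N : ℝ) ^ 2) atTop atTop :=
      (tendsto_pow_atTop two_ne_zero).comp tendsto_natCast_atTop_atTop
    have h0 : Tendsto (fun N : ℕ => κ / (N : ℝ) ^ 2) atTop (𝓝 0) := tendsto_const_nhds.div_atTop hsq
    exact h0.eventually (Iic_mem_nhds (hνpos j))
  have hev : ∀ᶠ N : ℕ in atTop, N₁ ≤ N ∧ 2 ≤ N ∧ κ / (N : ℝ) ^ 2 ≤ ν j :=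
    (eventually_ge_atTop N₁).and ((eventually_ge_atTop 2).and hκ)
  refine ((hreach (ν j) (hνpos j)).and_eventually hev).mono ?_
  rintro N ⟨hN, hN₁, hN2, hκN⟩
  obtain ⟨z, hzC, hzle⟩ := hN _ rfl _ rfl
  -- IVT: the component meets the slice `ν = ν j`
  have hνj0 : ν j ≤ ν₀ := (hνle j).trans (min_le_right _ _)
  have hνj1 : ν j ≤ ν₁ := (hνle j).trans (min_le_left _ _)
  obtain ⟨w, hwC, hw2⟩ := exists_mem_connectedComponentIn_snd_eq hzC hzle hνj0
  have hwF := connectedComponentIn_subset _ _ hwC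
  simp only [Set.mem_setOf_eq] at hwF
  obtain ⟨hwV, -, -, hw0, hwE⟩ := hwF
  -- non-depletion on the slice, in the resolved window
  have hwloud := hloud N hN₁ _ rfl _ rfl w hwC (by rw [hw2]; exact hκN) (by rw [hw2]; exact hνj1)
  rw [hw2] at hw0 hwloud
  -- the dictionary: coefficient state ↦ admissible tested-form field of the cell force
  refine ⟨fieldOf N w.1, steadyState_fieldOf hfmem hwV ?_, ?_, ?_⟩
  · rw [hfcoeff N]
    exact hw0
  · rw [integral_norm_sq_fieldOf hwV]
    exact hwE
  · rw [loudness_fieldOf (ν j) hwV]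
    exact hwloud



/-- **Composition of the line** (kernel-checked, no `sorry` outside the two stubs; concludes the route decl BY NAME):
the registered stubs `stub_reach`, `stub_loud` feed `loudWitness_of_subs`, and the landed `crux_iff` (`Iff.rfl`) closes.
Binder for binder this is `galerkinSteadyZerothLaw_of_subs` of the Theorems-bound split file. [folklore] -/
theorem GalerkinSteadyZerothLaw_of : GalerkinSteadyZerothLaw := crux_iff.2 (loudWitness_of_subs stub_reach stub_loud)

end Summit.AnomalousDissipation.AnomalousDissipation.Cruxes.GalerkinSteadyZerothLaw.LaminarComponentSplit

end
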